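import Literature.Computability.Complexity.IrreducibilityLLLResultant
import Literature.Algebra.EuclideanLattices.PQCLLLPolyTime
import Literature.Algebra.EuclideanLattices.GapSVPLLLFrontEnd
import Literature.Algebra.EuclideanLattices.LatticeProblemsProofs
import Mathlib.LinearAlgebra.Matrix.Block
import HarnessLib

/-!
# The LLL irreducibility criterion: one lattice reduction decides irreducibility (LLL 1982, §2–3)

Support file for the discharge of the named fact
`Literature.Computability.Complexity.lll_monicIrreducible_mem_P` (irreducibility of monic integer
polynomials is decidable in `P`; Lenstra–Lenstra–Lovász 1982, §3). Given a monic `f ∈ ℤ[X]` of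
degree `n`, a prime `p` with `f mod p` squarefree, a monic `u ∈ ℤ[X]` of degree `d < n` whose
reduction `ū` is an irreducible factor of `f mod p` and which divides `f` modulo `m = p^k`
(Berlekamp + Hensel, LLL82 (3.1)), the algorithm forms the lattice of LLL82 (2.3) (with the
paper's `m = n - 1`, i.e. polynomials of degree `< n`)

  `L = {g ∈ ℤ[X] : deg g < n, g ≡ u·(…) (mod p^k)} = Σᵢ<d ℤ·p^k Xⁱ ⊕ Σⱼ<n-d ℤ·u Xʲ ⊆ ℤⁿ`,

runs the LLL algorithm on its basis and compares the length of the first reduced vector `b₁`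
with the Mignotte bound: for `p^k` large, **`f` is irreducible iff `|b₁|² > 2^{n-1}·n·4ⁿ·|f|²`**
(LLL82 Prop. (2.13)/(3.5) specialised to the question "`deg h₀ = n`?"). This file proves that
criterion on the tree's lattice/LLL infrastructure (`Literature.Algebra.EuclideanLattices`:
`LatticeInstance`, `lllReduce`, Prop. (1.11) and Prop. (1.26), all proved there):

* `toVec`/`ofVec` — coefficient vectors of polynomials of degree `< n` and back; `rowPoly`,
  `factorMatrix n d u m`, `factorInstance` — the basis `{m Xⁱ}_{i<d} ∪ {u Xʲ}_{j<n-d}` of `L`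
  as an integer `LatticeInstance` (LLL82 (2.3) and the remark after (2.6): "a basis of `L`");
* `det_factorMatrix` (`= m^d`, lower triangular), `isNonsingular_factorInstance`;
* `exists_poly_of_mem_lattice` / `mem_lattice_of_modDvd` — **`L(factorMatrix) = L` exactly**:
  lattice vectors are the coefficient vectors of the `g` with `deg g < n`, `u ∣ g (mod m)`;
* `isLLLReduced_lllReduce_vec`, `sum_sq_first_row_le` — the output of the tree's `lllReduce` on a
  nonsingular instance is `3/4`-reduced, so its first row `b₁` has `|b₁|² ≤ 2^{n-1} |x|²` for every
  nonzero lattice vector `x` (LLL82 Prop. (1.11), tree theorem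
  `norm_vec_zero_le_sqrt_two_pow_mul_minNorm`);
* `testBound n S = 2^{n-1}·(n·4ⁿ·S)`, `precisionBound n S = S^{n-1}·(testBound n S)ⁿ`;
* **`irreducible_iff_testBound_lt`** — under the hypotheses above and
  `precisionBound n |f|² < p^{2k}`: `Irreducible f ↔ testBound n |f|² < |b₁|²`, where `b₁` is the
  first row of `lllReduce (factorInstance n d u p^k)`. (⇒: a short `b₁` would be a nonzero
  `g ∈ L`, `deg g < n`, with `|g|ⁿ |f|^{deg g} < p^k`, contradicting
  `natDegree_le_of_irreducible_of_modDvd`; ⇐: a proper monic factor `g₀` of `f` with `ū ∣ ḡ₀`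
  lies in `L` by `modDvd_of_modDvd_mul_of_isCoprime` and is short by Mignotte, so `b₁` is short.)

## References

* A. K. Lenstra, H. W. Lenstra Jr., L. Lovász, *Factoring polynomials with rational coefficients*,
  Math. Ann. 261 (1982) 515–534: (2.3) (the lattice `L` and its basis), Prop. (2.5)–(2.7),
  Prop. (2.13), (3.1)–(3.5). [LenstraLenstraLovasz1982] (not held; doi requested)
* M. R. Bremner, *Lattice Basis Reduction*, CRC Press 2011, §15.7 (after von zur Gathen–Gerhard
  §16.5): the lattice with basis `{u xⁱ} ∪ {p^k xⁱ}` and the test by the first reduced vector.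
  [Bremner2011] (held: book:bremnernd-lattice-basis-reduction, PDF pp. 243–250)
-/

noncomputable section

open Polynomial Finset Module Literature.Algebra.EuclideanLattices

namespace Literature.Computability.Complexity

namespace LLLFactoring

/-! ### Coefficient vectors -/

section Vec

variable {n : ℕ}

/-- The coefficient vector `(g₀, …, g_{n-1}) ∈ ℤⁿ` of a polynomial (meant for `deg g < n`).
[cite: LenstraLenstraLovasz1982, §2 (polynomials of degree ≤ m as points of ℤ^{m+1})] -/
def toVec (n : ℕ) (g : ℤ[X]) : Fin n → ℤ := fun j => g.coeff j

/-- The polynomial `Σⱼ vⱼ Xʲ` of a vector `v ∈ ℤⁿ`. [cite: LenstraLenstraLovasz1982, §2] -/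
def ofVec (v : Fin n → ℤ) : ℤ[X] := ∑ j : Fin n, monomial (j : ℕ) (v j)

/-- Unfolding of `toVec`. [folklore] -/
@[simp] theorem toVec_apply (g : ℤ[X]) (j : Fin n) : toVec n g j = g.coeff j := rfl

/-- Coefficients of `ofVec v`. [folklore] -/
theorem coeff_ofVec (v : Fin n → ℤ) (i : ℕ) :
    (ofVec v).coeff i = if h : i < n then v ⟨i, h⟩ else 0 := by
  unfold ofVec
  rw [finsetSum_coeff]
  simp only [coeff_monomial]
  split_ifs with h
  · rw [Finset.sum_eq_single ⟨i, h⟩]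
    · simp
    · intro j _ hj
      rw [if_neg]
      exact fun h' => hj (Fin.ext h')
    · simp
  · refine Finset.sum_eq_zero fun j _ => ?_
    rw [if_neg]
    intro h'
    exact h (h' ▸ j.isLt)

/-- `ofVec v` has degree `< n` (`n ≥ 1`). [folklore] -/
theorem natDegree_ofVec_lt (v : Fin n → ℤ) (hn : 0 < n) : (ofVec v).natDegree < n := by
  have : (ofVec v).natDegree ≤ n - 1 := by
    rw [natDegree_le_iff_coeff_eq_zero]
    intro N hN
    rw [coeff_ofVec, dif_neg (by omega)]
  omega

/-- `toVec ∘ ofVec = id`. [folklore] -/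
@[simp] theorem toVec_ofVec (v : Fin n → ℤ) : toVec n (ofVec v) = v := by
  funext j
  rw [toVec_apply, coeff_ofVec, dif_pos j.isLt]

/-- `ofVec ∘ toVec = id` on polynomials of degree `< n`. [folklore] -/
theorem ofVec_toVec {g : ℤ[X]} (hg : g.natDegree < n) : ofVec (toVec n g) = g := by
  ext i
  rw [coeff_ofVec]
  split_ifs with h
  · rfl
  · exact (coeff_eq_zero_of_natDegree_lt (by omega)).symm

/-- `ofVec v = 0 ↔ v = 0`. [folklore] -/
theorem ofVec_eq_zero_iff (v : Fin n → ℤ) : ofVec v = 0 ↔ v = 0 := by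
  constructor
  · intro h
    rw [← toVec_ofVec v, h]
    funext j
    simp
  · rintro rfl
    simp [ofVec]

/-- The squared norm of a polynomial of degree `< n` is that of its coefficient vector. [folklore] -/
theorem sum_sq_toVec {g : ℤ[X]} (hg : g.natDegree < n) : ∑ j : Fin n, toVec n g j ^ 2 = sqNorm g := by
  rw [sqNorm_eq_sum_range hg, ← Fin.sum_univ_eq_sum_range (fun i => g.coeff i ^ 2) n]
  rfl

/-- `‖v‖² = Σ vⱼ²` for an integer vector in `ℝⁿ`. [folklore] -/
theorem norm_sq_intVecToEuclidean' (v : Fin n → ℤ) :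
    ‖intVecToEuclidean n v‖ ^ 2 = ((∑ j, v j ^ 2 : ℤ) : ℝ) := by
  rw [norm_intVecToEuclidean, Real.sq_sqrt (Finset.sum_nonneg fun _ _ => sq_nonneg _)]
  push_cast
  rfl

end Vec

/-! ### The lattice of LLL82 (2.3) as an integer basis matrix -/

section Basis

variable {n d : ℕ} {u : ℤ[X]} {m : ℕ}

/-- The `i`-th basis polynomial of `L`: `m·Xⁱ` for `i < d` and `u·X^{i-d}` for `d ≤ i` (LLL82
(2.3) ff.: "`{p^k Xⁱ : 0 ≤ i < l} ∪ {h Xʲ : 0 ≤ j ≤ m - l}` is a basis of `L`").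
[cite: LenstraLenstraLovasz1982, (2.3) and the remark following (2.6)] -/
def rowPoly (d : ℕ) (u : ℤ[X]) (m : ℕ) (i : ℕ) : ℤ[X] :=
  if i < d then C (m : ℤ) * X ^ i else u * X ^ (i - d)

/-- Every basis polynomial is divisible by `u` modulo `m`. [cite: LenstraLenstraLovasz1982, (2.3)] -/
theorem modDvd_rowPoly (i : ℕ) : ModDvd m u (rowPoly d u m i) := by
  unfold rowPoly
  split_ifs
  · exact ModDvd.of_modulus_dvd (dvd_mul_right _ _)
  · exact ModDvd.of_dvd (dvd_mul_right _ _)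

/-- The basis polynomials have degree `< n` (`u` monic of degree `d ≤ n`, `i < n`). [folklore] -/
theorem natDegree_rowPoly_lt (hu : u.Monic) (hud : u.natDegree = d) {i : ℕ} (hi : i < n) :
    (rowPoly d u m i).natDegree < n := by
  unfold rowPoly
  split_ifs with h
  · calc (C (m : ℤ) * X ^ i).natDegree ≤ (X ^ i : ℤ[X]).natDegree := natDegree_C_mul_le _ _
      _ = i := natDegree_X_pow i
      _ < n := hi
  · rw [hu.natDegree_mul' (pow_ne_zero _ X_ne_zero), natDegree_X_pow, hud]
    omega

/-- Above the diagonal the basis matrix vanishes: `(rowPoly i)ⱼ = 0` for `i < j`. [folklore] -/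
theorem coeff_rowPoly_of_lt (hud : u.natDegree = d) {i j : ℕ} (hij : i < j) :
    (rowPoly d u m i).coeff j = 0 := by
  unfold rowPoly
  split_ifs with h
  · rw [coeff_C_mul, coeff_X_pow, if_neg (by omega), mul_zero]
  · rw [coeff_mul_X_pow']
    split_ifs with h'
    · exact coeff_eq_zero_of_natDegree_lt (by omega)
    · rfl

/-- The diagonal of the basis matrix: `m` on the first `d` rows, `1` (the leading coefficient of
`u`) afterwards. [folklore] -/
theorem coeff_rowPoly_self (hu : u.Monic) (hud : u.natDegree = d) (i : ℕ) :
    (rowPoly d u m i).coeff i = if i < d then (m : ℤ) else 1 := by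
  unfold rowPoly
  split_ifs with h
  · rw [coeff_C_mul, coeff_X_pow, if_pos rfl, mul_one]
  · rw [coeff_mul_X_pow', if_pos (Nat.sub_le i d), show i - (i - d) = d by omega, ← hud]
    exact hu.coeff_natDegree

/-- **The basis matrix of `L`** (rows = coefficient vectors of the `rowPoly i`, `i < n`).
[cite: LenstraLenstraLovasz1982, (2.3)] -/
def factorMatrix (n d : ℕ) (u : ℤ[X]) (m : ℕ) : Matrix (Fin n) (Fin n) ℤ :=
  Matrix.of fun i j => (rowPoly d u m i).coeff j

/-- The lattice `L` of LLL82 (2.3) as an instance of the tree's lattice problems.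
[cite: LenstraLenstraLovasz1982, (2.3)] -/
def factorInstance (n d : ℕ) (u : ℤ[X]) (m : ℕ) : LatticeInstance := ⟨n, factorMatrix n d u m⟩

/-- Entries of the basis matrix. [folklore] -/
@[simp] theorem factorMatrix_apply (i j : Fin n) :
    factorMatrix n d u m i j = (rowPoly d u m i).coeff j := rfl

/-- **`det = m^d`**: the basis matrix is lower triangular with diagonal `(m, …, m, 1, …, 1)`
(so `d(L) = p^{kl}`, LLL82 after (2.6)). [cite: LenstraLenstraLovasz1982, remark following (2.6) (d(L) = p^{kl})] -/
theorem det_factorMatrix (hu : u.Monic) (hud : u.natDegree = d) (hdn : d ≤ n) :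
    (factorMatrix n d u m).det = (m : ℤ) ^ d := by
  rw [Matrix.det_of_lowerTriangular]
  · have hdiag : ∀ i : Fin n, factorMatrix n d u m i i = if (i : ℕ) < d then (m : ℤ) else 1 :=
      fun i => coeff_rowPoly_self hu hud i
    simp_rw [hdiag]
    rw [Fin.prod_univ_eq_prod_range (fun i => if i < d then (m : ℤ) else 1) n,
      ← Finset.prod_range_mul_prod_Ico _ hdn]
    have h1 : ∏ i ∈ range d, (if i < d then (m : ℤ) else 1) = (m : ℤ) ^ d := by
      rw [Finset.prod_congr rfl fun i hi => if_pos (mem_range.1 hi), prod_const, card_range]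
    have h2 : ∏ i ∈ Ico d n, (if i < d then (m : ℤ) else 1) = 1 :=
      Finset.prod_eq_one fun i hi => if_neg (by have := (mem_Ico.1 hi).1; omega)
    rw [h1, h2, mul_one]
  · intro i j hij
    exact coeff_rowPoly_of_lt hud (by simpa using hij)

/-- The basis matrix is nonsingular (`m ≠ 0`). [cite: LenstraLenstraLovasz1982, (2.3)] -/
theorem isNonsingular_factorInstance (hu : u.Monic) (hud : u.natDegree = d) (hdn : d ≤ n) (hm : m ≠ 0) :
    (factorInstance n d u m).IsNonsingular := by
  change (factorMatrix n d u m).det ≠ 0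
  rw [det_factorMatrix hu hud hdn]
  exact pow_ne_zero _ (by exact_mod_cast hm)

/-- Integer combinations of the basis polynomials, coefficientwise: the coefficient vector of
`Σᵢ zᵢ · rowPoly i` is `z ᵥ* factorMatrix`. [folklore] -/
theorem toVec_sum_C_mul_rowPoly (z : Fin n → ℤ) :
    toVec n (∑ i : Fin n, C (z i) * rowPoly d u m i) = Matrix.vecMul z (factorMatrix n d u m) := by
  funext j
  rw [toVec_apply, finsetSum_coeff, Matrix.vecMul, dotProduct]
  refine Finset.sum_congr rfl fun i _ => ?_
  rw [coeff_C_mul, factorMatrix_apply]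

/-- **Lattice vectors are short-degree multiples of `u` modulo `m`**: every `x ∈ L(factorMatrix)`
is the coefficient vector of some `g` with `deg g < n` and `u ∣ g (mod m)`.
[cite: LenstraLenstraLovasz1982, (2.3)] -/
theorem exists_poly_of_mem_lattice (hu : u.Monic) (hud : u.natDegree = d) (hn : 0 < n)
    {x : EuclideanSpace ℝ (Fin n)} (hx : x ∈ (factorInstance n d u m).lattice) :
    ∃ g : ℤ[X], g.natDegree < n ∧ ModDvd m u g ∧ intVecToEuclidean n (toVec n g) = x := by
  obtain ⟨z, rfl⟩ := ((factorInstance n d u m).mem_lattice_iff x).1 hx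
  refine ⟨∑ i : Fin n, C (z i) * rowPoly d u m i, ?_, ?_, ?_⟩
  · have : (∑ i : Fin n, C (z i) * rowPoly d u m i).natDegree ≤ n - 1 := by
      refine natDegree_sum_le_of_forall_le _ _ fun i _ => ?_
      have := natDegree_rowPoly_lt (m := m) hu hud i.isLt
      exact (natDegree_C_mul_le _ _).trans (by omega)
    omega
  · exact Submodule.sum_mem _ fun i _ => (modDvd_rowPoly i).mul_left _
  · rw [toVec_sum_C_mul_rowPoly]
    rfl

/-- The basis polynomials recombine: `Σ_{i<d} rᵢ·(m Xⁱ) + Σ_{j<n-d} vⱼ·(u Xʲ) = m r + u v` for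
`deg r < d`, `deg v < n - d`. [folklore] -/
theorem sum_rowPoly_eq (hdn : d < n) {r v : ℤ[X]} (hr : r.natDegree < d)
    (hv : v.natDegree < n - d) :
    (∑ i ∈ range n, C (if i < d then r.coeff i else v.coeff (i - d)) * rowPoly d u m i) =
      C (m : ℤ) * r + u * v := by
  rw [← Finset.sum_range_add_sum_Ico _ hdn.le]
  congr 1
  · calc (∑ i ∈ range d, C (if i < d then r.coeff i else v.coeff (i - d)) * rowPoly d u m i)
        = ∑ i ∈ range d, C (m : ℤ) * monomial i (r.coeff i) := by
          refine Finset.sum_congr rfl fun i hi => ?_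
          have hi' : i < d := mem_range.1 hi
          rw [if_pos hi', rowPoly, if_pos hi', ← C_mul_X_pow_eq_monomial]
          ring
      _ = C (m : ℤ) * r := by
          rw [← Finset.mul_sum, ← as_sum_range' r d hr]
  · calc (∑ i ∈ Ico d n, C (if i < d then r.coeff i else v.coeff (i - d)) * rowPoly d u m i)
        = ∑ k ∈ range (n - d), u * monomial k (v.coeff k) := by
          rw [Finset.sum_Ico_eq_sum_range]
          refine Finset.sum_congr rfl fun k _ => ?_
          rw [if_neg (by omega), rowPoly, if_neg (by omega), Nat.add_sub_cancel_left,
            ← C_mul_X_pow_eq_monomial]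
          ring
      _ = u * v := by
          rw [← Finset.mul_sum, ← as_sum_range' v (n - d) hv]

/-- **Short-degree multiples of `u` modulo `m` are lattice vectors**: if `deg g < n` and
`u ∣ g (mod m)` then the coefficient vector of `g` lies in `L(factorMatrix)` (reduce the
`m`-cofactor modulo the monic `u`). Together with `exists_poly_of_mem_lattice`:
`L(factorMatrix) = {g : deg g < n, u ∣ g mod m}`, i.e. the rows form a basis of the lattice `L` of
LLL82 (2.3). [cite: LenstraLenstraLovasz1982, (2.3) and the remark following (2.6)] -/
theorem mem_lattice_of_modDvd (hu : u.Monic) (hud : u.natDegree = d) (hd : 0 < d) (hdn : d < n)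
    {g : ℤ[X]} (hg : g.natDegree < n) (hmod : ModDvd m u g) :
    intVecToEuclidean n (toVec n g) ∈ (factorInstance n d u m).lattice := by
  obtain ⟨v, w, hgvw⟩ := modDvd_iff.1 hmod
  set r := w %ₘ u with hr
  set q := w /ₘ u with hq
  set v' := v + C (m : ℤ) * q with hv'
  have hu1 : u ≠ 1 := fun h => by rw [h, natDegree_one] at hud; omega
  have hrd : r.natDegree < d := hud ▸ natDegree_modByMonic_lt w hu hu1
  have hgr : g = C (m : ℤ) * r + u * v' := by
    have := modByMonic_add_div w u
    rw [hgvw, hv', ← this]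
    ring
  have hv'deg : v'.natDegree < n - d := by
    by_cases h0 : v' = 0
    · rw [h0, natDegree_zero]; omega
    · have h1 : (u * v').natDegree = d + v'.natDegree := by rw [hu.natDegree_mul' h0, hud]
      have h2 : (u * v').natDegree < n := by
        have : u * v' = g - C (m : ℤ) * r := by rw [hgr]; ring
        rw [this]
        refine lt_of_le_of_lt (natDegree_sub_le _ _) (max_lt hg ?_)
        exact (natDegree_C_mul_le _ _).trans_lt (by omega)
      omega
  -- the coefficient vector
  set z : Fin n → ℤ := fun i => if (i : ℕ) < d then r.coeff i else v'.coeff (i - d) with hz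
  have hsum : (∑ i : Fin n, C (z i) * rowPoly d u m i) = g := by
    rw [Fin.sum_univ_eq_sum_range (fun i => C (if i < d then r.coeff i else v'.coeff (i - d)) * rowPoly d u m i) n,
      sum_rowPoly_eq hdn hrd hv'deg, hgr]
  refine ((factorInstance n d u m).mem_lattice_iff _).2 ⟨z, ?_⟩
  change intVecToEuclidean n (Matrix.vecMul z (factorMatrix n d u m)) = _
  rw [← toVec_sum_C_mul_rowPoly, hsum]

end Basis

/-! ### The first vector of the reduced basis -/

/-- **The tree's `lllReduce` outputs a `3/4`-reduced basis** on nonsingular input (assembled, as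
in `lll_polyTime_of`, from the proved loop invariant `isLLLReduced_of_halted_holds` and
termination `lll_halts_within_holds`). [cite: LenstraLenstraLovasz1982, Prop. (1.26)] -/
theorem isLLLReduced_lllReduce_vec {I : LatticeInstance} (hI : I.IsNonsingular) :
    IsLLLReduced (3 / 4) I.lllReduce.vec := by
  set φ := (intVecToEuclidean I.n).toAddMonoidHom with hφ
  have hli : LinearIndependent ℝ (⇑(intVecToEuclidean I.n) ∘ I.basis) :=
    LatticeInstance.linearIndependent_vec hI
  set B : ℝ := ∑ i, ‖intVecToEuclidean I.n (I.basis i)‖ ^ 2 with hB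
  have hBi : ∀ i, ‖intVecToEuclidean I.n (I.basis i)‖ ^ 2 ≤ B := fun i =>
    Finset.single_le_sum (f := fun i => ‖intVecToEuclidean I.n (I.basis i)‖ ^ 2)
      (fun j _ => sq_nonneg _) (Finset.mem_univ i)
  have hhalted := lll_halts_within_holds (3 / 4) B I.basis (by norm_num) (by norm_num) hli hBi
  have hinv := isLLLReduced_of_halted_holds φ (3 / 4) I.basis _ hhalted
  rw [← lllResult_eq_of_halted φ hhalted] at hinv
  exact hinv

/-- The reduced instance is nonsingular with the input. [folklore] -/
theorem isNonsingular_lllReduce {I : LatticeInstance} (hI : I.IsNonsingular) :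
    I.lllReduce.IsNonsingular :=
  LatticeInstance.isNonsingular_of_lattice_eq hI I.lllReduce_lattice

/-- **LLL82 Prop. (1.11) for the first output row**: for a nonsingular instance of dimension
`n ≥ 1` and every nonzero lattice vector `x`, the first row `b₁` of `lllReduce` satisfies
`Σⱼ b₁ⱼ² ≤ 2^{n-1} ‖x‖²`. [cite: LenstraLenstraLovasz1982, Prop. (1.11)] -/
theorem sum_sq_first_row_le {I : LatticeInstance} (hI : I.IsNonsingular) (hn : I.n ≠ 0)
    {x : EuclideanSpace ℝ (Fin I.n)} (hx : x ∈ I.lattice) (hx0 : x ≠ 0) :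
    ((∑ j, I.lllReduce.basis ⟨0, Nat.pos_of_ne_zero hn⟩ j ^ 2 : ℤ) : ℝ) ≤ 2 ^ (I.n - 1) * ‖x‖ ^ 2 := by
  have hI' := isNonsingular_lllReduce hI
  have hred := isLLLReduced_lllReduce_vec hI
  have h1 := norm_vec_zero_le_sqrt_two_pow_mul_minNorm hI' hn hred
  rw [I.lllReduce_lattice] at h1
  have h2 : minNorm I.lattice ≤ ‖x‖ := minNorm_le_norm_of_mem hx hx0
  have h3 : ‖I.lllReduce.vec ⟨0, Nat.pos_of_ne_zero hn⟩‖ ≤ Real.sqrt 2 ^ (I.n - 1) * ‖x‖ :=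
    h1.trans (mul_le_mul_of_nonneg_left h2 (by positivity))
  have h4 := pow_le_pow_left₀ (norm_nonneg _) h3 2
  rw [mul_pow, ← pow_mul, mul_comm (I.n - 1) 2, pow_mul, Real.sq_sqrt (by norm_num)] at h4
  have h5 : ‖I.lllReduce.vec ⟨0, Nat.pos_of_ne_zero hn⟩‖ ^ 2 =
      ((∑ j, I.lllReduce.basis ⟨0, Nat.pos_of_ne_zero hn⟩ j ^ 2 : ℤ) : ℝ) :=
    norm_sq_intVecToEuclidean' _
  rw [← h5]
  exact h4

/-! ### The criterion -/

/-- The threshold `2^{n-1}·(n·4ⁿ·S)` compared with `|b₁|²` (`S = |f|²`; `n·4ⁿ·|f|²` bounds `|h|²`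
for every factor `h` of `f` of degree `< n`, Mignotte). [cite: LenstraLenstraLovasz1982, (3.3)–(3.5) (the comparison of |b₁| with the Mignotte bound)] -/
def testBound (n : ℕ) (S : ℤ) : ℤ := 2 ^ (n - 1) * (n * 4 ^ n * S)

/-- The precision the modulus must exceed: `p^{2k} > |f|^{2(n-1)}·(2^{n-1} n 4ⁿ |f|²)ⁿ` (LLL82
(2.14)/(3.3): `p^{kl} > 2^{mn/2} (2m choose m)^{n/2} |f|^{m+n}`, here squared and with the cruder
Mignotte constant). [cite: LenstraLenstraLovasz1982, (3.3)] -/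
def precisionBound (n : ℕ) (S : ℤ) : ℤ := S ^ (n - 1) * testBound n S ^ n

/-- `testBound` is monotone and nonnegative in `S ≥ 0`. [folklore] -/
theorem testBound_nonneg (n : ℕ) {S : ℤ} (hS : 0 ≤ S) : 0 ≤ testBound n S := by
  unfold testBound; positivity

variable {f u : ℤ[X]} {p k d n : ℕ}

/-- A monic polynomial different from `1` has positive degree. [folklore] -/
theorem natDegree_pos_of_monic_ne_one {g : ℤ[X]} (hg : g.Monic) (h1 : g ≠ 1) : 0 < g.natDegree := by
  by_contra h
  exact h1 (eq_one_of_monic_natDegree_zero hg (by omega))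

/-- **The LLL irreducibility criterion (LLL82 Prop. (2.13) for the question `h₀ = f`).**
Let `f ∈ ℤ[X]` be monic of degree `n`, `p` a prime with `f mod p` squarefree, `u ∈ ℤ[X]` monic
of degree `d` with `0 < d < n`, `ū = u mod p` irreducible, `u ∣ f (mod p^k)`, and
`precisionBound n |f|² < p^{2k}`. Let `b₁` be the first row of the LLL-reduced basis
`lllReduce (factorInstance n d u p^k)` of `L = {g : deg g < n, u ∣ g mod p^k}`. Then
`f` is irreducible iff `testBound n |f|² < Σⱼ b₁ⱼ²`.
[cite: LenstraLenstraLovasz1982, Prop. (2.13) and (3.5)] [cite: Bremner2011, §15.7] -/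
theorem irreducible_iff_testBound_lt (hp : p.Prime) (hk : 0 < k) (hf : f.Monic)
    (hfn : f.natDegree = n) (hu : u.Monic) (hud : u.natDegree = d) (hd : 0 < d) (hdn : d < n)
    (hirr : Irreducible (u.map (Int.castRingHom (ZMod p))))
    (hsq : Squarefree (f.map (Int.castRingHom (ZMod p))))
    (hfu : ModDvd (p ^ k) u f)
    (hK : precisionBound n (sqNorm f) < ((p ^ k : ℕ) : ℤ) ^ 2) :
    Irreducible f ↔
      testBound n (sqNorm f) <
        ∑ j, (factorInstance n d u (p ^ k)).lllReduce.basis ⟨0, by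
          show 0 < n; omega⟩ j ^ 2 := by
  haveI : Fact p.Prime := ⟨hp⟩
  set m : ℕ := p ^ k with hm
  set I := factorInstance n d u m with hIdef
  have hn0 : 0 < n := by omega
  have hm2 : 2 ≤ m := by
    rw [hm]; exact le_trans hp.two_le (Nat.le_self_pow hk.ne' p)
  have hm0 : m ≠ 0 := by omega
  have hI : I.IsNonsingular := isNonsingular_factorInstance hu hud hdn.le hm0
  have hIn : I.n ≠ 0 := by show n ≠ 0; omega
  have hf0 : f ≠ 0 := hf.ne_zero
  have hS1 : 1 ≤ sqNorm f := one_le_sqNorm_of_monic hf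
  have hS0 : 0 ≤ sqNorm f := sqNorm_nonneg f
  set b₁ : Fin n → ℤ := I.lllReduce.basis ⟨0, hn0⟩ with hb₁
  set N : ℤ := ∑ j, b₁ j ^ 2 with hN
  change Irreducible f ↔ testBound n (sqNorm f) < N
  -- the first row as a polynomial `g ∈ L`
  have hrow_mem : I.lllReduce.vec ⟨0, hn0⟩ ∈ I.lattice := by
    rw [← I.lllReduce_lattice]
    show I.lllReduce.vec ⟨0, hn0⟩ ∈ Submodule.span ℤ (Set.range I.lllReduce.vec)
    exact Submodule.subset_span ⟨_, rfl⟩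
  obtain ⟨g, hgn, hgmod, hgvec⟩ := exists_poly_of_mem_lattice hu hud hn0 hrow_mem
  have hgb : toVec n g = b₁ := intVecToEuclidean_injective n hgvec
  have hNg : N = sqNorm g := by rw [hN, ← hgb, sum_sq_toVec hgn]
  have hg0 : g ≠ 0 := by
    intro h0
    apply isNonsingular_lllReduce hI
    refine Matrix.det_eq_zero_of_row_eq_zero ⟨0, hn0⟩ fun j => ?_
    have : b₁ j = 0 := by rw [← hgb, h0, toVec_apply, coeff_zero]
    exact this
  constructor
  · -- (⇒) irreducible `f` forces a long first vector
    intro hirrf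
    by_contra hle
    push Not at hle
    -- `|g|ⁿ |f|^{deg g} < m`
    have hlt : rnorm g ^ f.natDegree * rnorm f ^ g.natDegree < m := by
      have hsq_le : sqNorm g ≤ testBound n (sqNorm f) := hNg ▸ hle
      have hA : sqNorm g ^ n ≤ testBound n (sqNorm f) ^ n := pow_le_pow_left₀ (sqNorm_nonneg g) hsq_le n
      have hB : sqNorm f ^ g.natDegree ≤ sqNorm f ^ (n - 1) := pow_le_pow_right₀ hS1 (by omega)
      have hZ : sqNorm g ^ n * sqNorm f ^ g.natDegree ≤ precisionBound n (sqNorm f) := by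
        unfold precisionBound
        calc sqNorm g ^ n * sqNorm f ^ g.natDegree ≤ testBound n (sqNorm f) ^ n * sqNorm f ^ (n - 1) :=
              mul_le_mul hA hB (pow_nonneg hS0 _) (pow_nonneg (testBound_nonneg n hS0) _)
          _ = sqNorm f ^ (n - 1) * testBound n (sqNorm f) ^ n := mul_comm _ _
      have h1 : (rnorm g ^ f.natDegree * rnorm f ^ g.natDegree) ^ 2 ≤ (precisionBound n (sqNorm f) : ℝ) := by
        rw [mul_pow, ← pow_mul, ← pow_mul, mul_comm f.natDegree 2, mul_comm g.natDegree 2, pow_mul,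
          pow_mul, rnorm_sq, rnorm_sq, hfn]
        exact_mod_cast hZ
      have h2 : (precisionBound n (sqNorm f) : ℝ) < (m : ℝ) ^ 2 := by exact_mod_cast hK
      exact lt_of_pow_lt_pow_left₀ 2 (by positivity) (h1.trans_lt h2)
    have := natDegree_le_of_irreducible_of_modDvd hm2 hf hirrf hu (hud ▸ hd) hfu hgmod hg0 hlt
    omega
  · -- (⇐) a proper factor would give a short lattice vector
    intro hlt
    by_contra hnot
    have hf1 : f ≠ 1 := fun h => by rw [h, natDegree_one] at hfn; omega
    rw [irreducible_of_monic hf hf1] at hnot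
    push Not at hnot
    obtain ⟨g₁, g₂, hg₁, hg₂, hprod, hg₁1, hg₂1⟩ := hnot
    -- `ū` divides one of the two factors modulo `p`
    set φ := Int.castRingHom (ZMod p) with hφ
    obtain ⟨wbar, hwbar⟩ : u.map φ ∣ f.map φ := by
      obtain ⟨v, hv⟩ := (hfu.of_modulus_dvd_modulus (dvd_pow_self p hk.ne')).exists_map_eq
      exact ⟨v.map φ, hv⟩
    have hdvd12 : u.map φ ∣ g₁.map φ * g₂.map φ := by
      rw [← Polynomial.map_mul, hprod]; exact ⟨wbar, hwbar⟩
    have key : ∀ g h : ℤ[X], g.Monic → h.Monic → g * h = f → g ≠ 1 → h ≠ 1 →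
        u.map φ ∣ g.map φ → False := by
      intro g h hg hh hgh hg1 hh1 hug
      have hgpos := natDegree_pos_of_monic_ne_one hg hg1
      have hhpos := natDegree_pos_of_monic_ne_one hh hh1
      have hdegs : g.natDegree + h.natDegree = n := by rw [← hfn, ← hgh, hg.natDegree_mul hh]
      have hgn : g.natDegree < n := by omega
      -- `u ∣ g (mod m)` by inverting the coprime cofactor `h`
      have hcop : IsCoprime (u.map φ) (h.map φ) := by
        rw [hirr.coprime_iff_not_dvd]
        intro huh
        have hsq2 : u.map φ * u.map φ ∣ f.map φ := by
          rw [← hgh, Polynomial.map_mul]; exact mul_dvd_mul hug huh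
        exact hirr.not_isUnit (hsq _ hsq2)
      have hgmod : ModDvd m u g :=
        modDvd_of_modDvd_mul_of_isCoprime (q := p) (k := k) (by rw [hgh]; exact hfu) hcop
      -- the coefficient vector of `g` is a short nonzero lattice vector
      have hmem := mem_lattice_of_modDvd (m := m) hu hud hd hdn hgn hgmod
      have hx0 : intVecToEuclidean n (toVec n g) ≠ 0 := by
        intro h0
        have : toVec n g = 0 := intVecToEuclidean_injective n (by rw [h0, map_zero])
        have : g = 0 := by rw [← ofVec_toVec hgn, this]; simp [ofVec]
        exact hg.ne_zero this
      have hfirst : ((∑ j, b₁ j ^ 2 : ℤ) : ℝ) ≤ 2 ^ (n - 1) * ‖intVecToEuclidean n (toVec n g)‖ ^ 2 :=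
        sum_sq_first_row_le hI hIn hmem hx0
      rw [norm_sq_intVecToEuclidean', sum_sq_toVec hgn] at hfirst
      -- Mignotte: `|g|² ≤ n 4^{n-1} |f|²`
      have hmig : sqNorm g ≤ ((n - 1 : ℕ) + 1) * 4 ^ (n - 1) * sqNorm f :=
        sqNorm_le_of_dvd hf0 ⟨h, hgh.symm⟩ (by omega)
      have hmig' : sqNorm g ≤ n * 4 ^ n * sqNorm f := by
        refine hmig.trans ?_
        have h41 : (4 : ℤ) ^ (n - 1) ≤ 4 ^ n := pow_le_pow_right₀ (by norm_num) (Nat.sub_le n 1)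
        have hn1 : ((n - 1 : ℕ) + 1 : ℤ) = n := by
          have : n - 1 + 1 = n := Nat.sub_add_cancel hn0
          exact_mod_cast this
        rw [hn1]
        gcongr
      -- so `N ≤ testBound`
      have hNle : (N : ℝ) ≤ testBound n (sqNorm f) := by
        have : (N : ℝ) ≤ 2 ^ (n - 1) * (sqNorm g : ℝ) := by exact_mod_cast hfirst
        refine this.trans ?_
        rw [testBound]
        push_cast
        gcongr
        exact_mod_cast hmig'
      have : N ≤ testBound n (sqNorm f) := by exact_mod_cast hNle
      omega
    rcases (hirr.prime.dvd_or_dvd hdvd12) with h1 | h2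
    · exact key g₁ g₂ hg₁ hg₂ hprod hg₁1 hg₂1 h1
    · exact key g₂ g₁ hg₂ hg₁ (by rw [mul_comm, hprod]) hg₂1 hg₁1 h2

end LLLFactoring

end Literature.Computability.Complexity
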